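import Summits.QuantumFields.YangMills.Theorems.ChatterjeeMassGapTorusAxialFreeLink
import HarnessLib

/-!
# S28ᵀ (Chatterjee torus-axial mass gap) — private links kill centred plaquette products
(ym-idea-4 g6, LINE-13)

Bears on rung S28ᵀ through the fork `S28BoxBit.gapCore_eventually_of_boxCumulant` (LINE-10).
For a finite family of plaquettes `(x_b; i_b, j_b)_{b ∈ s}` of `ℤᵈ` and the free product Haar
measure `dg_∞ = zdHaar d G` (every compact second-countable `G`, every continuous matrix `ρ`,
`m₀(ρ) = ∫_G Re tr ρ dg`):

* `integral_prod_centred_plaquetteObs_eq_zero_of_privateLink` — if some member `a` has a PRIVATE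
  link `ℓ` (a link of `a` that is a link of no other member), then
  `∫ ∏_{b ∈ s} (Re tr ρ(U_b) - m₀) dg_∞ = 0`;
* `integral_prod_plaquetteObs_eq_of_privateLink` — uncentred form:
  `∫ ∏_{b ∈ s} Re tr ρ(U_b) dg_∞ = m₀ · ∫ ∏_{b ≠ a} Re tr ρ(U_b) dg_∞`.

These are the two uses of LINE-11's free-link averaging in the (O1)/(O2) blueprint
(pub/ideators/ym-idea-4/bc/g6/O1O2-PLAN.md): (O1.4) a tuple of plaquettes one of whose DISTINCT
positions has a private link contributes `0` to the joint cumulant (with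
`Literature.Probability.LatticeModels.ursellOf_eq_zero_of_factorises`), and (O1.6) the "sphere
property" of the box boundary `∂B` — every proper non-empty sub-family of its ten faces has a
private link, so every proper centred sub-moment vanishes and the joint cumulant of the ten faces
IS the centred moment `κ_□`. Bookkeeping aids: `dependsOn_plaquetteObs` (a plaquette observable
depends only on its four links) and `dependsOn_finset_prod`.

No summit is proved here: Haar-measure glue for the island (small-β) case of the S28ᵀ gap core.
-/

noncomputable section

open MeasureTheory Filter Topology
open Literature.MathematicalPhysics.QuantumLattice
open Literature.MathematicalPhysics.QuantumFieldTheory (zdHaar haarProbability)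
open Literature.Probability.LatticeModels (Site)

namespace Summit.QuantumFields.YangMills.Theorems.S28PrivateLink

open S28FreeLink

variable {N : ℕ} {G : Type} [Group G] [TopologicalSpace G] [IsTopologicalGroup G]
  [CompactSpace G] [MeasurableSpace G] [BorelSpace G] (ρ : G →* Matrix (Fin N) (Fin N) ℂ)
variable {d : ℕ}

/-! ### Dependence bookkeeping -/

omit [TopologicalSpace G] [IsTopologicalGroup G] [CompactSpace G] [MeasurableSpace G]
  [BorelSpace G] in
/-- A plaquette observable depends only on the four links of its plaquette. [folklore] -/
theorem dependsOn_plaquetteObs (x : Site d) (i j : Fin d) :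
    DependsOn (plaquetteObs (G := G) ρ x i j)
      ({(x, i), (x + Pi.single i 1, j), (x + Pi.single j 1, i), (x, j)} : Set (ZdEdge d)) := by
  intro U V h
  unfold plaquetteObs plaquetteHolonomyZd
  rw [h (x, i) (by simp), h (x + Pi.single i 1, j) (by simp), h (x + Pi.single j 1, i) (by simp),
    h (x, j) (by simp)]

omit [Group G] [TopologicalSpace G] [IsTopologicalGroup G] [CompactSpace G] [MeasurableSpace G]
  [BorelSpace G] in
/-- A finite product depends on the union of the dependence sets of its factors. [folklore] -/
theorem dependsOn_finset_prod {ι : Type*} (s : Finset ι) {F : ι → LGConfig d G → ℝ}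
    {S : ι → Set (ZdEdge d)} (h : ∀ b ∈ s, DependsOn (F b) (S b)) :
    DependsOn (fun U : LGConfig d G => ∏ b ∈ s, F b U) (⋃ b ∈ s, S b) := by
  intro U V hUV
  refine Finset.prod_congr rfl fun b hb => h b hb fun e he => hUV e ?_
  exact Set.mem_biUnion hb he

omit [Group G] [TopologicalSpace G] [IsTopologicalGroup G] [CompactSpace G] [MeasurableSpace G]
  [BorelSpace G] in
/-- Subtracting a constant does not change the dependence set. [folklore] -/
theorem dependsOn_sub_const {F : LGConfig d G → ℝ} {S : Set (ZdEdge d)} (h : DependsOn F S)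
    (c : ℝ) : DependsOn (fun U => F U - c) S :=
  fun U V hUV => by simp only [h hUV]

/-! ### Private links -/

/-- **A private link kills the centred product.** Let `(x_b; i_b, j_b)_{b ∈ s}` be finitely many
plaquettes, `a ∈ s` with `i_a ≠ j_a`, and `ℓ` a link of the plaquette `a` which is a link of no
other member of the family. Then `∫ ∏_{b ∈ s} (Re tr ρ(U_b) - m₀(ρ)) dg_∞ = 0`
(`S28FreeLink.integral_centred_plaquetteObs_mul_eq_zero` with the other factors as the spectator,
which does not feel the shear of `ℓ` by `dependsOn_plaquetteObs`). [folklore] -/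
theorem integral_prod_centred_plaquetteObs_eq_zero_of_privateLink [SecondCountableTopology G]
    (hρ : Continuous ρ) {ι : Type*} [DecidableEq ι] (s : Finset ι) (x : ι → Site d)
    (i j : ι → Fin d) {a : ι} (ha : a ∈ s) (hij : i a ≠ j a) {ℓ : ZdEdge d}
    (hℓ : ℓ = (x a, i a) ∨ ℓ = (x a + Pi.single (i a) 1, j a) ∨
      ℓ = (x a + Pi.single (j a) 1, i a) ∨ ℓ = (x a, j a))
    (hpriv : ∀ b ∈ s, b ≠ a → ℓ ∉ ({(x b, i b), (x b + Pi.single (i b) 1, j b),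
      (x b + Pi.single (j b) 1, i b), (x b, j b)} : Set (ZdEdge d))) :
    ∫ U, ∏ b ∈ s, (plaquetteObs ρ (x b) (i b) (j b) U - ∫ g, (ρ g).trace.re ∂haarProbability G)
      ∂zdHaar d G = 0 := by
  set m₀ : ℝ := ∫ g, (ρ g).trace.re ∂haarProbability G
  have hsplit : ∀ U : LGConfig d G,
      ∏ b ∈ s, (plaquetteObs ρ (x b) (i b) (j b) U - m₀) =
        (plaquetteObs ρ (x a) (i a) (j a) U - m₀) *
          ∏ b ∈ s.erase a, (plaquetteObs ρ (x b) (i b) (j b) U - m₀) := fun U =>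
    (Finset.mul_prod_erase s (fun b => plaquetteObs ρ (x b) (i b) (j b) U - m₀) ha).symm
  simp_rw [hsplit]
  have hYc : Continuous fun U : LGConfig d G =>
      ∏ b ∈ s.erase a, (plaquetteObs ρ (x b) (i b) (j b) U - m₀) :=
    continuous_finsetProd _ fun b _ => (continuous_plaquetteObs ρ hρ (x b) (i b) (j b)).sub
      continuous_const
  have hYd : DependsOn (fun U : LGConfig d G =>
      ∏ b ∈ s.erase a, (plaquetteObs ρ (x b) (i b) (j b) U - m₀))
      (⋃ b ∈ s.erase a, ({(x b, i b), (x b + Pi.single (i b) 1, j b),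
        (x b + Pi.single (j b) 1, i b), (x b, j b)} : Set (ZdEdge d))) :=
    dependsOn_finset_prod (s.erase a) fun b _ =>
      dependsOn_sub_const (dependsOn_plaquetteObs ρ (x b) (i b) (j b)) m₀
  have hℓU : ℓ ∉ ⋃ b ∈ s.erase a, ({(x b, i b), (x b + Pi.single (i b) 1, j b),
      (x b + Pi.single (j b) 1, i b), (x b, j b)} : Set (ZdEdge d)) := by
    intro hmem
    simp only [Set.mem_iUnion] at hmem
    obtain ⟨b, hb, hmem⟩ := hmem
    exact hpriv b (Finset.mem_of_mem_erase hb) (Finset.ne_of_mem_erase hb) hmem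
  exact integral_centred_plaquetteObs_mul_eq_zero ρ hρ (x a) hij hℓ hYc
    (shear_invariant_of_dependsOn hYd hℓU)

/-- **A private link averages its plaquette out of the product.** Same setting, uncentred:
`∫ ∏_{b ∈ s} Re tr ρ(U_b) dg_∞ = m₀(ρ) · ∫ ∏_{b ∈ s, b ≠ a} Re tr ρ(U_b) dg_∞`; in particular the
whole product integrates to `0` when `m₀(ρ) = 0` (non-trivial irreducible `ρ`, e.g.
`HaarCentreTwist.integral_trace_eq_zero` for `G ≅ SU(N)`, `N ≥ 2`). [folklore] -/
theorem integral_prod_plaquetteObs_eq_of_privateLink [SecondCountableTopology G]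
    (hρ : Continuous ρ) {ι : Type*} [DecidableEq ι] (s : Finset ι) (x : ι → Site d)
    (i j : ι → Fin d) {a : ι} (ha : a ∈ s) (hij : i a ≠ j a) {ℓ : ZdEdge d}
    (hℓ : ℓ = (x a, i a) ∨ ℓ = (x a + Pi.single (i a) 1, j a) ∨
      ℓ = (x a + Pi.single (j a) 1, i a) ∨ ℓ = (x a, j a))
    (hpriv : ∀ b ∈ s, b ≠ a → ℓ ∉ ({(x b, i b), (x b + Pi.single (i b) 1, j b),
      (x b + Pi.single (j b) 1, i b), (x b, j b)} : Set (ZdEdge d))) :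
    ∫ U, ∏ b ∈ s, plaquetteObs ρ (x b) (i b) (j b) U ∂zdHaar d G =
      (∫ g, (ρ g).trace.re ∂haarProbability G) *
        ∫ U, ∏ b ∈ s.erase a, plaquetteObs ρ (x b) (i b) (j b) U ∂zdHaar d G := by
  have hsplit : ∀ U : LGConfig d G,
      ∏ b ∈ s, plaquetteObs ρ (x b) (i b) (j b) U =
        plaquetteObs ρ (x a) (i a) (j a) U * ∏ b ∈ s.erase a, plaquetteObs ρ (x b) (i b) (j b) U :=
    fun U => (Finset.mul_prod_erase s (fun b => plaquetteObs ρ (x b) (i b) (j b) U) ha).symm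
  simp_rw [hsplit]
  have hYc : Continuous fun U : LGConfig d G =>
      ∏ b ∈ s.erase a, plaquetteObs ρ (x b) (i b) (j b) U :=
    continuous_finsetProd _ fun b _ => continuous_plaquetteObs ρ hρ (x b) (i b) (j b)
  have hYd : DependsOn (fun U : LGConfig d G => ∏ b ∈ s.erase a, plaquetteObs ρ (x b) (i b) (j b) U)
      (⋃ b ∈ s.erase a, ({(x b, i b), (x b + Pi.single (i b) 1, j b),
        (x b + Pi.single (j b) 1, i b), (x b, j b)} : Set (ZdEdge d))) :=
    dependsOn_finset_prod (s.erase a) fun b _ => dependsOn_plaquetteObs ρ (x b) (i b) (j b)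
  have hℓU : ℓ ∉ ⋃ b ∈ s.erase a, ({(x b, i b), (x b + Pi.single (i b) 1, j b),
      (x b + Pi.single (j b) 1, i b), (x b, j b)} : Set (ZdEdge d)) := by
    intro hmem
    simp only [Set.mem_iUnion] at hmem
    obtain ⟨b, hb, hmem⟩ := hmem
    exact hpriv b (Finset.mem_of_mem_erase hb) (Finset.ne_of_mem_erase hb) hmem
  exact integral_plaquetteObs_mul_eq_of_freeLink ρ hρ (x a) hij hℓ hYc
    (shear_invariant_of_dependsOn hYd hℓU)

end Summit.QuantumFields.YangMills.Theorems.S28PrivateLink
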